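import Summits.QuantumFields.YangMills.Theorems.FluctuationComparisonRegPrIntLS2BetaChartReadGaugeAndLocality
import Literature.MathematicalPhysics.QuantumFieldTheory.Balaban1983to89.BlockAveragingSectionPlaq
import Literature.MathematicalPhysics.QuantumFieldTheory.Balaban1983to89.B15Eq177GaugeInvariance
import HarnessLib

/-!
# S2β ∕ GAP♯∘ strata residue, (RINV-curl) brick (B3′) — THE FACE-PREIMAGE IDENTITY `DM(X^{+μ}) = e_B ⊗ (λ(ι_k x) − DM(I)(B))`
# (generic `P : Params`, `SU(N)`; DEFINITION-FREE)

Cell `ym3-torus` (YM ladder rung R3 = continuum `SU(2)` Yang–Mills on the three-torus — a RUNG: NOT d = 4, NOT infinite volume,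
NOT a mass gap, NOT Clay).  Width seat «width 16» `ym3-torus-px16` (gen 21), FREE px helper on crux `stmt-QuantumFields-20520`
(`FluctuationComparisonRegPrIntL`), count-neutral, DEFINITION-FREE (0 `def`, 0 `instance`, 0 `notation`, 0 `sorry`), default heartbeats.

WHAT.  The algebraic heart of the face-preimage road to (RINV-curl) (bus 13:44Z; door ✓∕⧗`…S2BetaPreimagesOfFaceSpreads`): fix a coarse bond `B = ⟨x, μ⟩` at
level `k` (`k + 1 ≤ m + K`, so every direction has `2L^{m+K−k} ≥ 2L ≥ 6` blocks), a generator `λ : T_η → 𝔰𝔲(N)` SUPPORTED ON THE BLOCK `B^k(x)`, and a chart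
direction `Ȧ` reading the infinitesimal gauge transformation `D_{U₀}λ` (`↑(Ȧ b) = λ(b₋) − U₀(b)λ(b₊)U₀(b)*`).  Split `Ȧ` by the `k`-block labels of the two
endpoints of each finest bond: the FACE PART `X^{+μ}` (bonds from `B^k(x)` to `B^k(x + e_μ)`), the INTERIOR PART `I` (bonds inside `B^k(x)`), and the rest
(the other `2d − 1` faces; `Ȧ = 0` off the block).  Then, with `DM = DΨ_k(0)` the derivative of pub-ymgap N09's chart-read k-fold (0.4) average (✓p823800):
* ★★`fderiv_chartRead_iter_faceSupported_apply_of_ne` — for `B′ ≠ B`, `(DM X)(B′) = 0` for EVERY direction `X` supported on the `+μ` face bonds (no guard on `U₀`):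
  the face bonds are read by `B` only ((B1′) ✓`…ChartReadGaugeAndLocality.fderiv_chartRead_iter_apply_eq_zero_of_forall` + §1's torus bookkeeping);
* ★★★`coe_fderiv_chartRead_iter_facePart_apply_self` — under the (0.4) guard below `k`:  **`↑((DM X^{+μ}) B) = λ(ι_k x) − ↑((DM I) B)`**
  ((B2) ✓`coe_fderiv_chartRead_iter_gaugeTangent` on `Ȧ` — the coarse generator `λ ∘ ι_k` vanishes at `x + e_μ` —, linearity of `DM`, and (B1′) on the remainder
  `Ȧ − X^{+μ} − I`, which vanishes on the read set of `B`: a bond from `B^k(x + e_μ)` never ends in `B^k(x)` when there are ≥ 3 blocks per direction).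
So `DM(X^{+μ}(v̂)) = e_B ⊗ (v̂ − u_B(v̂))` with `u_B(v̂) := (DM I_{v̂})(B)` once `λ(ι_k x) = v̂` — the `hDM` input of the door; `‖u_B‖ ≤ ½` is (D2) (px13 g25) × the
thin-loop smallness of `I` (comb transporter), and the face curl count bounds `Σ_p‖curl X^{+μ}‖` — separate files.
* §1 torus bookkeeping (any `P`): `three_le_sitesPerDir` (`k + 1 ≤ m + K`), `shift_eq_shift_iff`, `ne_shift_self`, `shift_shift_ne_self`,
  ★`blockIter_shift_or` (`B^k(z + e_ν) ∈ {B^k(z), B^k(z) + e_ν}`, iterating lit ✓`BlockAveragingSectionPlaq.blockOf_shift`), `blockIter_tgt_or`.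

HONEST SCOPE.  Locality + covariance of the tree's own averaging, read at the derivative, plus torus bookkeeping; nothing of Bałaban's analysis is asserted;
(D2), the thin-loop bound, the face curl count, (RINV-curl), MULT♮, AVG₂♭-ax, «CRIT-ax», (D-ax), GAP♯∘ (`stub_uniformFibreGapOrbit`; registry
`Lines/semiclassical_s2beta.lean` 3732b7df UNTOUCHED), the five registered stubs, S2β, crux 20520, 19936, 19200 and `YM3TorusSU2` are NOT proved; no registered
stub is closed; the Yang–Mills mass gap is NOT proved.  Sorry-free, axioms standard.

References: T. Bałaban, CMP **98** (1985) 17–51 [Balaban1985Averaging] ((11)–(13) p.19, (125) p.36); CMP **109** (1987) 249–301 [Balaban1987RG1]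
((0.1)–(0.4) pp.251–253, (0.11) p.253).
-/

set_option autoImplicit false

noncomputable section

open scoped Matrix.Norms.L2Operator Topology
open Filter Set Function

namespace Summit.QuantumFields.YangMills.Theorems.FluctuationComparisonRegPrIntLS2BetaFacePreimageIdentity

open Literature.MathematicalPhysics.QuantumFieldTheory.Balaban1983to89
open Literature.MathematicalPhysics.QuantumFieldTheory.Balaban1983to89.BlockAveraging (blockAvg)
open Literature.MathematicalPhysics.QuantumFieldTheory.Balaban1983to89.B14.Eq22Determines (blockIter blockIter_zero blockIter_succ)
open Literature.MathematicalPhysics.QuantumFieldTheory.Balaban1983to89.B15DeterminingSets (embIter)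
open Literature.MathematicalPhysics.QuantumFieldTheory.Balaban1983to89.B15Eq177GaugeInvariance (blockIter_embIter)
open Literature.MathematicalPhysics.QuantumFieldTheory.Balaban1983to89.BlockAveragingSectionPlaq (offset blockOf_shift)

/-! ## §1 Torus bookkeeping: shifts at a level with at least two ∕ three sites per direction, and the `k`-block of a shifted site -/

section Torus

variable {P : Params}

/-- Below the top level, `sitesPerDir k ≥ 2L ≥ 6 > 2`. [cite: Balaban1987RG1, (0.1) p.251 (bookkeeping)] -/
theorem three_le_sitesPerDir {k : ℕ} (hk : k + 1 ≤ P.m + P.K) : 3 ≤ P.sitesPerDir k := by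
  unfold Params.sitesPerDir
  have hL := P.hL.2
  have h1 : P.L ≤ P.L ^ (P.m + P.K - k) := by
    calc P.L = P.L ^ 1 := (pow_one _).symm
      _ ≤ P.L ^ (P.m + P.K - k) := Nat.pow_le_pow_right P.L_pos (by omega)
  omega

/-- Two different unit shifts of a site differ (at least two sites per direction). [folklore] -/
theorem shift_eq_shift_iff {k : ℕ} (x : Site P k) (μ ν : Fin P.d) : x.shift μ = x.shift ν ↔ μ = ν := by
  refine ⟨fun h => ?_, fun h => by rw [h]⟩
  by_contra hne
  have hμ := congrFun h μ
  simp only [Site.shift, Function.update_self, Function.update_of_ne hne] at hμ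
  exact one_ne_zero (add_eq_left.1 hμ)

/-- A site differs from its unit shift (`1 ≠ 0` in `ZMod (2L^{m+K−k})`; stated as `x ≠ x + e_μ`). [folklore] -/
theorem ne_shift_self {k : ℕ} (x : Site P k) (μ : Fin P.d) : x ≠ x.shift μ := by
  intro h
  have hμ := congrFun h μ
  simp only [Site.shift, Function.update_self] at hμ
  exact one_ne_zero (add_eq_left.1 hμ.symm)

/-- Below the top level two unit shifts never return to the start (at least three sites per direction). [folklore] -/
theorem shift_shift_ne_self {k : ℕ} (hk : k + 1 ≤ P.m + P.K) (x : Site P k) (μ ν : Fin P.d) : (x.shift μ).shift ν ≠ x := by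
  intro h
  by_cases hμν : ν = μ
  · subst hμν
    have hμ := congrFun h ν
    simp only [Site.shift, Function.update_self] at hμ
    have h2 : ((2 : ℕ) : ZMod (P.sitesPerDir k)) = 0 := by
      have h' := congrArg (fun t => t - x ν) hμ
      simp only [add_assoc, add_sub_cancel_left, sub_self] at h'
      rw [show (1 : ZMod (P.sitesPerDir k)) + 1 = ((2 : ℕ) : ZMod (P.sitesPerDir k)) by push_cast; norm_num] at h'
      exact h'
    rw [ZMod.natCast_eq_zero_iff] at h2
    have := Nat.le_of_dvd two_pos h2
    have := three_le_sitesPerDir (P := P) hk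
    omega
  · have hν := congrFun h ν
    simp only [Site.shift, Function.update_self, Function.update_of_ne hμν] at hν
    exact one_ne_zero (add_eq_left.1 hν)

/-- **THE `k`-BLOCK OF A SHIFTED SITE** is the `k`-block of the site or its shift (iterate lit ✓`BlockAveragingSectionPlaq.blockOf_shift`; standing range). [cite: Balaban1987RG1, (0.3) p.252] -/
theorem blockIter_shift_or : ∀ (k : ℕ), k ≤ P.m + P.K → ∀ (z : Site P 0) (ν : Fin P.d),
    blockIter k (z.shift ν) = blockIter k z ∨ blockIter k (z.shift ν) = (blockIter k z).shift ν
  | 0, _, _, _ => Or.inr rfl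
  | k + 1, hk, z, ν => by
    rw [blockIter_succ, blockIter_succ]
    rcases blockIter_shift_or k (Nat.le_of_succ_le hk) z ν with h | h
    · exact Or.inl (by rw [h])
    · rw [h, blockOf_shift hk]
      split_ifs
      · exact Or.inr rfl
      · exact Or.inl rfl

/-- The two `k`-block labels of a finest bond: `B^k(b₊) = B^k(b₋)` or `B^k(b₋) + e_{dir b}`. [cite: Balaban1987RG1, (0.3) p.252] -/
theorem blockIter_tgt_or {k : ℕ} (hk : k ≤ P.m + P.K) (b : PBond P 0) :
    blockIter k b.tgt = blockIter k b.src ∨ blockIter k b.tgt = (blockIter k b.src).shift b.dir :=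
  blockIter_shift_or k hk b.src b.dir

end Torus

/-! ## §2 The face-preimage identity -/

section Face

open Literature.MathematicalPhysics.QuantumFieldTheory.Balaban1983to89.HaarExponentialChart
open Literature.MathematicalPhysics.QuantumFieldTheory.Balaban1983to89.HaarExponentialChart.IsChartRep
open Literature.MathematicalPhysics.QuantumFieldTheory.Balaban1983to89.ExpMeanLog (expMeanLogSU deltaSU)
open Literature.MathematicalPhysics.QuantumFieldTheory.Balaban1983to89.Node00 hiding blockIter
open Literature.MathematicalPhysics.QuantumLattice (fundamentalRep fundamentalRep_apply)
open Summit.QuantumFields.YangMills.Theorems.FluctuationComparisonRegPrIntLS2BetaChartReadGaugeAndLocality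

variable {P : Params} {N : ℕ} [NeZero N]

/-- ★★ **OFF THE FACE BOND, THE FACE SPREAD IS INVISIBLE**: for `B′ ≠ ⟨x, μ⟩` the `B′`-component of `DΨ_k(0)` kills every direction supported on the finest bonds from
`B^k(x)` to `B^k(x + e_μ)` (the `+μ` face of the block) — ✓`fderiv_chartRead_iter_apply_eq_zero_of_forall` + torus bookkeeping (`k + 1 ≤ m + K`: at least `2L ≥ 6` blocks
per direction, so the face bonds are read by `⟨x, μ⟩` only).  No guard on `U₀`. [cite: Balaban1987RG1, (0.3)-(0.4) p.252-253; Balaban1985Averaging, p.19 (locality)] -/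
theorem fderiv_chartRead_iter_faceSupported_apply_of_ne (U₀ : GaugeField P 0 (SU N)) {k : ℕ} (hk : k + 1 ≤ P.m + P.K) (x : Site P k) (μ : Fin P.d)
    (X : PBond P 0 → (specialUnitaryLogChart (Fin N)).lie) (hX : ∀ b : PBond P 0, ¬ (blockIter k b.src = x ∧ blockIter k b.tgt = x.shift μ) → X b = 0)
    {B' : PBond P k} (hB' : B' ≠ ⟨x, μ⟩) :
    fderiv ℝ (fun (A : PBond P 0 → (specialUnitaryLogChart (Fin N)).lie) (c : PBond P k) =>
        (isChartRep_specialUnitaryGroup (n := Fin N)).logChart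
          (Averaging.iter (fun i => blockAvg (P := P) (j := i) (expMeanLogSU (n := Fin N))) k
              (fun b => (isChartRep_specialUnitaryGroup (n := Fin N)).expChart (A b) * U₀ b) c *
            (Averaging.iter (fun i => blockAvg (P := P) (j := i) (expMeanLogSU (n := Fin N))) k U₀ c)⁻¹)) 0 X B' = 0 := by
  have hk' : k ≤ P.m + P.K := Nat.le_of_succ_le hk
  refine fderiv_chartRead_iter_apply_eq_zero_of_forall U₀ hk' B' X fun b hs ht => hX b fun hface => ?_
  obtain ⟨h1, h2⟩ := hface
  rw [h1] at hs; rw [h2] at ht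
  -- `x ∈ {B′₋, B′₊}` and `x + e_μ ∈ {B′₋, B′₊}` force `B′ = ⟨x, μ⟩`
  have htgt : B'.tgt = B'.src.shift B'.dir := rfl
  rcases hs with hs | hs <;> rcases ht with ht | ht
  · exact (ne_shift_self x μ).symm (ht.trans hs.symm)
  · apply hB'
    rw [htgt, ← hs, shift_eq_shift_iff] at ht
    cases B'; simp only at hs ht; rw [← hs, ← ht]
  · rw [htgt, ← ht] at hs
    exact shift_shift_ne_self hk x μ B'.dir hs.symm
  · exact (ne_shift_self x μ).symm (ht.trans hs.symm)

/-- ★★★ **THE FACE-PREIMAGE IDENTITY ON THE FACE BOND.**  Under the (0.4) guard below `k` (`k + 1 ≤ m + K`), for a generator `λ : T_η → 𝔰𝔲(N)` SUPPORTED ON THE BLOCK `B^k(x)`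
and a chart direction `Ȧ` reading `D_{U₀}λ` (`↑(Ȧ b) = λ(b₋) − U₀(b)λ(b₊)U₀(b)*`), its FACE PART `X^{+μ}` (`Ȧ` on the bonds from `B^k(x)` to `B^k(x + e_μ)`, else `0`) and
INTERIOR PART `I` (`Ȧ` on the bonds inside `B^k(x)`, else `0`) satisfy
  `↑((DΨ_k(0) X^{+μ})⟨x, μ⟩) = λ(ι_k x) − ↑((DΨ_k(0) I)⟨x, μ⟩)`
((B2) ✓`coe_fderiv_chartRead_iter_gaugeTangent` on `Ȧ` — the coarse generator vanishes at `ι_k(x + e_μ) ∉ B^k(x)` —, linearity of `DΨ_k(0)`, and (B1′) on the remainder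
`Ȧ − X^{+μ} − I`, which vanishes on the read set of `⟨x, μ⟩`). [cite: Balaban1985Averaging, (11)-(13) p.19, (125) p.36; Balaban1987RG1, (0.4), (0.11) p.253] -/
theorem coe_fderiv_chartRead_iter_facePart_apply_self (U₀ : GaugeField P 0 (SU N)) {k : ℕ} (hk : k + 1 ≤ P.m + P.K)
    (hsb : SmallBelow (fun i => blockAvg (P := P) (j := i) (expMeanLogSU (n := Fin N))) k U₀) (x : Site P k) (μ : Fin P.d)
    (lam : Site P 0 → (specialUnitaryLogChart (Fin N)).lie) (hlam : ∀ z : Site P 0, blockIter k z ≠ x → lam z = 0)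
    (Adot : PBond P 0 → (specialUnitaryLogChart (Fin N)).lie)
    (hAdot : ∀ b : PBond P 0, (Adot b : Matrix (Fin N) (Fin N) ℂ) =
      (lam b.src : Matrix (Fin N) (Fin N) ℂ) - (U₀ b : Matrix (Fin N) (Fin N) ℂ) * (lam b.tgt : Matrix (Fin N) (Fin N) ℂ) * star (U₀ b : Matrix (Fin N) (Fin N) ℂ)) :
    ((fderiv ℝ (fun (A : PBond P 0 → (specialUnitaryLogChart (Fin N)).lie) (c : PBond P k) =>
        (isChartRep_specialUnitaryGroup (n := Fin N)).logChart
          (Averaging.iter (fun i => blockAvg (P := P) (j := i) (expMeanLogSU (n := Fin N))) k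
              (fun b => (isChartRep_specialUnitaryGroup (n := Fin N)).expChart (A b) * U₀ b) c *
            (Averaging.iter (fun i => blockAvg (P := P) (j := i) (expMeanLogSU (n := Fin N))) k U₀ c)⁻¹)) 0
        (fun b => if blockIter k b.src = x ∧ blockIter k b.tgt = x.shift μ then Adot b else 0) ⟨x, μ⟩ :
        (specialUnitaryLogChart (Fin N)).lie) : Matrix (Fin N) (Fin N) ℂ) =
      (lam (embIter k x) : Matrix (Fin N) (Fin N) ℂ) -
      ((fderiv ℝ (fun (A : PBond P 0 → (specialUnitaryLogChart (Fin N)).lie) (c : PBond P k) =>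
        (isChartRep_specialUnitaryGroup (n := Fin N)).logChart
          (Averaging.iter (fun i => blockAvg (P := P) (j := i) (expMeanLogSU (n := Fin N))) k
              (fun b => (isChartRep_specialUnitaryGroup (n := Fin N)).expChart (A b) * U₀ b) c *
            (Averaging.iter (fun i => blockAvg (P := P) (j := i) (expMeanLogSU (n := Fin N))) k U₀ c)⁻¹)) 0
        (fun b => if blockIter k b.src = x ∧ blockIter k b.tgt = x then Adot b else 0) ⟨x, μ⟩ :
        (specialUnitaryLogChart (Fin N)).lie) : Matrix (Fin N) (Fin N) ℂ) := by
  have hk' : k ≤ P.m + P.K := Nat.le_of_succ_le hk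
  set DM := fderiv ℝ (fun (A : PBond P 0 → (specialUnitaryLogChart (Fin N)).lie) (c : PBond P k) =>
        (isChartRep_specialUnitaryGroup (n := Fin N)).logChart
          (Averaging.iter (fun i => blockAvg (P := P) (j := i) (expMeanLogSU (n := Fin N))) k
              (fun b => (isChartRep_specialUnitaryGroup (n := Fin N)).expChart (A b) * U₀ b) c *
            (Averaging.iter (fun i => blockAvg (P := P) (j := i) (expMeanLogSU (n := Fin N))) k U₀ c)⁻¹)) 0 with hDM
  set X : PBond P 0 → (specialUnitaryLogChart (Fin N)).lie := fun b => if blockIter k b.src = x ∧ blockIter k b.tgt = x.shift μ then Adot b else 0 with hXdef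
  set I : PBond P 0 → (specialUnitaryLogChart (Fin N)).lie := fun b => if blockIter k b.src = x ∧ blockIter k b.tgt = x then Adot b else 0 with hIdef
  -- `Ȧ` vanishes on bonds with no endpoint in the block
  have hAdot0 : ∀ b : PBond P 0, blockIter k b.src ≠ x → blockIter k b.tgt ≠ x → Adot b = 0 := by
    intro b hs ht
    apply Subtype.ext
    rw [hAdot b, hlam _ hs, hlam _ ht, ZeroMemClass.coe_zero, mul_zero, zero_mul, sub_zero]
  -- the remainder `R = Ȧ − X − I` vanishes on the read set of `⟨x, μ⟩`
  have hR : DM (Adot - X - I) ⟨x, μ⟩ = 0 := by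
    refine fderiv_chartRead_iter_apply_eq_zero_of_forall U₀ hk' ⟨x, μ⟩ (Adot - X - I) fun b hs ht => ?_
    have htgt : (⟨x, μ⟩ : PBond P k).tgt = x.shift μ := rfl
    rw [htgt] at hs ht
    simp only [Pi.sub_apply, hXdef, hIdef]
    rcases hs with hs | hs
    · rcases ht with ht | ht
      · rw [if_neg (fun h => (ne_shift_self x μ).symm (h.2.symm.trans ht)), if_pos ⟨hs, ht⟩, sub_zero, sub_self]
      · rw [if_pos ⟨hs, ht⟩, if_neg (fun h => (ne_shift_self x μ).symm (ht.symm.trans h.2)), sub_zero, sub_self]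
    · -- source in `B^k(x + e_μ)`: then the target is there too (never back in `B^k(x)`), and `Ȧ b = 0`
      have hsx : blockIter k b.src ≠ x := by rw [hs]; exact (ne_shift_self x μ).symm
      have htx : blockIter k b.tgt ≠ x := by
        intro h
        rcases blockIter_tgt_or hk' b with h' | h'
        · exact hsx (h'.symm.trans h ▸ rfl)
        · rw [h, hs] at h'
          exact shift_shift_ne_self hk x μ b.dir h'.symm
      rw [if_neg (fun h => hsx h.1), if_neg (fun h => hsx h.1), hAdot0 b hsx htx, sub_zero, sub_zero]
  -- linearity and (B2)
  have hsplit : DM X ⟨x, μ⟩ = DM Adot ⟨x, μ⟩ - DM I ⟨x, μ⟩ := by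
    have h : X = Adot - I - (Adot - X - I) := by abel
    rw [h, map_sub, map_sub, Pi.sub_apply, Pi.sub_apply, hR, sub_zero]
  have hgauge := coe_fderiv_chartRead_iter_gaugeTangent U₀ hk' hsb lam Adot hAdot ⟨x, μ⟩
  have hfar : lam (embIter k ((⟨x, μ⟩ : PBond P k).tgt)) = 0 := by
    refine hlam _ ?_
    rw [blockIter_embIter k hk']
    exact (ne_shift_self x μ).symm
  rw [hfar, ZeroMemClass.coe_zero, mul_zero, zero_mul, sub_zero] at hgauge
  have hgauge' : ((DM Adot ⟨x, μ⟩ : (specialUnitaryLogChart (Fin N)).lie) : Matrix (Fin N) (Fin N) ℂ) = (lam (embIter k x) : Matrix (Fin N) (Fin N) ℂ) :=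
    hgauge
  show ((DM X ⟨x, μ⟩ : (specialUnitaryLogChart (Fin N)).lie) : Matrix (Fin N) (Fin N) ℂ) =
    (lam (embIter k x) : Matrix (Fin N) (Fin N) ℂ) - ((DM I ⟨x, μ⟩ : (specialUnitaryLogChart (Fin N)).lie) : Matrix (Fin N) (Fin N) ℂ)
  rw [hsplit, Submodule.coe_sub, hgauge']

end Face

end Summit.QuantumFields.YangMills.Theorems.FluctuationComparisonRegPrIntLS2BetaFacePreimageIdentity

end
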